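import Summits.CriticalPhenomena.SAWScalingLimit.Theorems.SAWLoopFugacityFlowIsingBoundaryRatioWindowRectCover
import Summits.CriticalPhenomena.SAWScalingLimit.Theorems.SAWLoopFugacityFlowIsingBoundaryRatioWindowRectTails
import Literature.Probability.RandomPlanarGeometry.PlanarDomains
import HarnessLib

/-!
# Non-interleaving of whiskers, I: the test segments miss the two half-loops
(line `fk-anchor-transfer`, crux `IsingBoundaryRatio`, stmt-CriticalPhenomena-10650; helper file of the stub
`windowRectPresentation_holds`)

Setting of the non-interleaving theorem (`…WindowRectNonInterleave`): the boundary cycle `d₀, d₁, …, d_{N-1}`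
of `E`, four positions `0 < j < l < m < N` carrying rough darts with feet `p_ν = framePt δ d_ν S_ν 0` on
`∂D`, the tails `[bud_ν, p_ν]` of `0, l`, an outside set `R_A` (outside `closure D` but for the feet
`p_l, p_0`). We show that the test segment of `d_j` misses the tails of `0, l`, the set `R_A` and the second
arc `arcPath d_l (N - l)` of the polygon, and that the test segment of `d_m` misses the tails, `R_A` and the
first arc `arcPath d₀ l` (`joinedIn_test_second_arc`, `joinedIn_test_first_arc`). [folklore]
-/

noncomputable section

open scoped Classical
open Set Metric Complex Literature.Probability.LatticeModels Literature.Probability.LatticeModels.DiscreteRect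
  Literature.Probability.RandomPlanarGeometry

namespace Summit.CriticalPhenomena.SAWScalingLimit.Theorems.IsingBoundaryRatio

namespace WindowRect

variable (D : JordanDomain) {δ η : ℝ} (hδ : 0 < δ) (hη : 0 < η) (h4 : 4 * η ≤ δ) {E : Finset (Sym2 (Site 2))}
  (hball : ∀ v ∈ verts E, ball (meshPoint δ v) (2 * η) ⊆ D.carrier)
  {d₀ : Site 2 × Fin 4} (hd₀ : IsExtDart E d₀) {N : ℕ} (hN : (succ E)^[N] d₀ = d₀)
  (hinj : ∀ i j, i < N → j < N → (succ E)^[i] d₀ = (succ E)^[j] d₀ → i = j)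

/-! ### Points near a vertex -/

/-- A frame point with both coordinates at most `5η/4` lies in the ball of radius `2η` about its lattice
point. [folklore] -/
theorem dist_framePt_lt_two (hη : 0 < η) (x : Site 2) (k : Fin 4) {a b : ℝ} (ha : |a| ≤ 5 * η / 4)
    (hb : |b| ≤ 5 * η / 4) : dist (framePt δ (x, k) a b) (meshPoint δ x) < 2 * η := by
  rw [dist_eq_norm, ← abs_norm, ← abs_of_pos (by linarith : 0 < 2 * η), ← sq_lt_sq, ← Complex.normSq_eq_norm_sq,
    normSq_framePt_sub]
  have ha2 : a ^ 2 ≤ (5 * η / 4) ^ 2 := by rw [← sq_abs a]; exact pow_le_pow_left₀ (abs_nonneg a) ha 2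
  have hb2 : b ^ 2 ≤ (5 * η / 4) ^ 2 := by rw [← sq_abs b]; exact pow_le_pow_left₀ (abs_nonneg b) hb 2
  nlinarith

include hball in
/-- Such a point at a vertex of `E` lies in `D`. [folklore] -/
theorem near_mem (hη : 0 < η) {x : Site 2} (hx : x ∈ verts E) (k : Fin 4) {a b : ℝ} (ha : |a| ≤ 5 * η / 4)
    (hb : |b| ≤ 5 * η / 4) : framePt δ (x, k) a b ∈ D.carrier :=
  hball x hx (mem_ball.2 (dist_framePt_lt_two hη x k ha hb))

/-- A point of `D` is not in an outside set (outside `closure D` but for two feet outside `D`). [folklore] -/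
theorem not_mem_outside {RA : Set ℂ} {p q : ℂ} (hRA : ∀ z ∈ RA, z ∉ closure D.carrier ∨ z = p ∨ z = q)
    (hp : p ∉ D.carrier) (hq : q ∉ D.carrier) {z : ℂ} (hz : z ∈ D.carrier) : z ∉ RA := by
  intro h
  rcases hRA z h with h' | rfl | rfl
  · exact h' (subset_closure hz)
  · exact hp hz
  · exact hq hz

/-! ### Test points against the polygon arcs and the tails -/

include hδ hη h4 in
/-- **A test point `framePt δ d_ν (η + u) c` (`|u| ≤ η/4`, `|c| ≤ η/2`) on an arc of the polygon is at a
dart of that arc.** [folklore] -/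
theorem exists_of_test_mem_arcPath {d : Site 2 × Fin 4} {u c : ℝ} (hu : |u| ≤ η / 4) (hc : |c| ≤ η / 2)
    (a n : ℕ) (hz : framePt δ d (η + u) c ∈ range (arcPath E δ η ((succ E)^[a] d₀) n)) :
    ∃ i ≤ n, (succ E)^[a + i] d₀ = d := by
  have hu' : |u| < η := by linarith
  have hc' : |c| < η := by linarith
  rw [show d = (d.1, d.2) from rfl] at hz ⊢
  rcases range_arcPath_subset hη (by linarith) _ n hz with ⟨i, hi, h⟩ | ⟨e, he, t, ht, h⟩
  · refine ⟨i, hi, ?_⟩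
    have := (test_side hδ hη h4 hu' hc' (v := ((succ E)^[i] ((succ E)^[a] d₀)).1)
      (K := ((succ E)^[i] ((succ E)^[a] d₀)).2) h).1
    rw [← Function.iterate_add_apply, add_comm] at this
    exact this
  · exact (test_not_conn hδ hη h4 hu' hc' he ht h).elim

include hδ hη h4 hd₀ hinj in
/-- **A test point of `d_ν` (`0 < ν < N`, `ν ∉ {0, l}`) is not on the tails of `d₀` and `d_l`.** The tails are
`framePt δ d s 0`, `η ≤ s ≤ S ≤ δ`, stopping `2η` before a vertex far end. [folklore] -/
theorem test_not_mem_tail {ν μ : ℕ} (hν : ν < N) (hμ : μ < N) (hνμ : ν ≠ μ) {u c : ℝ} (hu : |u| ≤ η / 4)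
    (hc : |c| ≤ η / 2) {S : ℝ} (hSη : η ≤ S) (hS : S ≤ δ)
    (hstop : ((succ E)^[μ] d₀).1 + dir ((succ E)^[μ] d₀).2 ∈ verts E → S ≤ δ - 2 * η) :
    framePt δ ((succ E)^[ν] d₀) (η + u) c ∉
      segment ℝ (framePt δ ((succ E)^[μ] d₀) η 0) (framePt δ ((succ E)^[μ] d₀) S 0) := by
  intro hz
  obtain ⟨s, hs, hzs⟩ := exists_of_mem_segment_fst hSη hz
  have hne : (((succ E)^[μ] d₀).1, ((succ E)^[μ] d₀).2) ≠ (((succ E)^[ν] d₀).1, ((succ E)^[ν] d₀).2) := by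
    intro h
    exact hνμ (hinj ν μ hν hμ (Prod.ext_iff.2 ⟨(Prod.ext_iff.1 h).1.symm, (Prod.ext_iff.1 h).2.symm⟩))
  exact test_ne_tail hδ hη h4 (hd₀.iterate ν).1 hu hc hne hs.1 (hs.2.trans hS)
    (fun h => by linarith [hstop h, hs.2]) hzs

/-! ### The test segments miss the half-loops -/

include hδ hη h4 hd₀ hN hinj hball in
/-- **The test segment of `d_j` misses the tails of `d₀, d_l`, the outside set `R_A`, and the second arc
`arcPath d_l (N - l)`** (`0 < j < l ≤ N`). [folklore] -/
theorem joinedIn_test_second_arc {j l : ℕ} (hj : 0 < j) (hjl : j < l) (hlN : l < N) {S0 Sl : ℝ}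
    (hS0 : η ≤ S0 ∧ S0 ≤ δ) (hSl : η ≤ Sl ∧ Sl ≤ δ)
    (hstop0 : d₀.1 + dir d₀.2 ∈ verts E → S0 ≤ δ - 2 * η)
    (hstopl : ((succ E)^[l] d₀).1 + dir ((succ E)^[l] d₀).2 ∈ verts E → Sl ≤ δ - 2 * η)
    (hp0 : framePt δ d₀ S0 0 ∉ D.carrier) (hpl : framePt δ ((succ E)^[l] d₀) Sl 0 ∉ D.carrier)
    {RA : Set ℂ} (hRA : ∀ z ∈ RA, z ∉ closure D.carrier ∨ z = framePt δ ((succ E)^[l] d₀) Sl 0 ∨ z = framePt δ d₀ S0 0) :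
    JoinedIn ((segment ℝ (framePt δ ((succ E)^[l] d₀) η 0) (framePt δ ((succ E)^[l] d₀) Sl 0) ∪ RA ∪
        segment ℝ (framePt δ d₀ η 0) (framePt δ d₀ S0 0)) ∪ range (arcPath E δ η ((succ E)^[l] d₀) (N - l)))ᶜ
      (framePt δ ((succ E)^[j] d₀) (η - η / 4) (η / 2)) (framePt δ ((succ E)^[j] d₀) (η + η / 4) (η / 2)) := by
  have hjN : j < N := by omega
  have hN0 : 0 < N := by omega
  refine JoinedIn.of_segment_subset fun z hz hzK => ?_
  obtain ⟨t, ht, rfl⟩ := exists_of_mem_segment_fst (by linarith) hz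
  obtain ⟨u, rfl, hu⟩ : ∃ u, t = η + u ∧ |u| ≤ η / 4 := ⟨t - η, by ring, by
    rw [abs_le]; constructor <;> linarith [ht.1, ht.2]⟩
  have hc : |η / 2| ≤ η / 2 := by rw [abs_of_pos (by linarith)]
  simp only [mem_union] at hzK
  rcases hzK with ((hzK | hzK) | hzK) | hzK
  · exact test_not_mem_tail hδ hη h4 hd₀ hinj hjN (by omega) (by omega) hu hc hSl.1 hSl.2 hstopl hzK
  · refine not_mem_outside D hRA hpl hp0 ?_ hzK
    exact near_mem D hball hη (hd₀.iterate j).1 _ (by rw [abs_le] at hu ⊢; constructor <;> linarith [hu.1, hu.2])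
      (by linarith [abs_nonneg (η / 2)])
  · have := test_not_mem_tail (E := E) hδ hη h4 hd₀ hinj hjN hN0 (by omega) hu hc hS0.1 hS0.2 (μ := 0)
      (by simpa using hstop0)
    exact this (by simpa using hzK)
  · obtain ⟨i, hi, he⟩ := exists_of_test_mem_arcPath hδ hη h4 hu hc l (N - l) hzK
    rcases (show l + i < N ∨ l + i = N by omega) with h | h
    · have := hinj _ _ h hjN he; omega
    · rw [h, hN] at he
      have := hinj 0 j hN0 hjN (by simpa using he); omega

include hδ hη h4 hd₀ hinj hball in
/-- **The test segment of `d_m` misses the tails of `d₀, d_l`, the outside set `R_A`, and the first arc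
`arcPath d₀ l`** (`0 < l < m < N`). [folklore] -/
theorem joinedIn_test_first_arc {l m : ℕ} (hl : 0 < l) (hlm : l < m) (hmN : m < N) {S0 Sl : ℝ}
    (hS0 : η ≤ S0 ∧ S0 ≤ δ) (hSl : η ≤ Sl ∧ Sl ≤ δ)
    (hstop0 : d₀.1 + dir d₀.2 ∈ verts E → S0 ≤ δ - 2 * η)
    (hstopl : ((succ E)^[l] d₀).1 + dir ((succ E)^[l] d₀).2 ∈ verts E → Sl ≤ δ - 2 * η)
    (hp0 : framePt δ d₀ S0 0 ∉ D.carrier) (hpl : framePt δ ((succ E)^[l] d₀) Sl 0 ∉ D.carrier)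
    {RA : Set ℂ} (hRA : ∀ z ∈ RA, z ∉ closure D.carrier ∨ z = framePt δ ((succ E)^[l] d₀) Sl 0 ∨ z = framePt δ d₀ S0 0) :
    JoinedIn (range (arcPath E δ η d₀ l) ∪ (segment ℝ (framePt δ ((succ E)^[l] d₀) η 0) (framePt δ ((succ E)^[l] d₀) Sl 0) ∪
        RA ∪ segment ℝ (framePt δ d₀ η 0) (framePt δ d₀ S0 0)))ᶜ
      (framePt δ ((succ E)^[m] d₀) (η - η / 4) (η / 2)) (framePt δ ((succ E)^[m] d₀) (η + η / 4) (η / 2)) := by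
  have hN0 : 0 < N := by omega
  refine JoinedIn.of_segment_subset fun z hz hzK => ?_
  obtain ⟨t, ht, rfl⟩ := exists_of_mem_segment_fst (by linarith) hz
  obtain ⟨u, rfl, hu⟩ : ∃ u, t = η + u ∧ |u| ≤ η / 4 := ⟨t - η, by ring, by
    rw [abs_le]; constructor <;> linarith [ht.1, ht.2]⟩
  have hc : |η / 2| ≤ η / 2 := by rw [abs_of_pos (by linarith)]
  simp only [mem_union] at hzK
  rcases hzK with hzK | ((hzK | hzK) | hzK)
  · have hzK' : framePt δ ((succ E)^[m] d₀) (η + u) (η / 2) ∈ range (arcPath E δ η ((succ E)^[0] d₀) l) := by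
      rwa [Function.iterate_zero, id_eq]
    obtain ⟨i, hi, he⟩ := exists_of_test_mem_arcPath hδ hη h4 hu hc 0 l hzK'
    rw [zero_add] at he
    have := hinj i m (by omega) hmN he; omega
  · exact test_not_mem_tail hδ hη h4 hd₀ hinj hmN (by omega) (by omega) hu hc hSl.1 hSl.2 hstopl hzK
  · refine not_mem_outside D hRA hpl hp0 ?_ hzK
    exact near_mem D hball hη (hd₀.iterate m).1 _ (by rw [abs_le] at hu ⊢; constructor <;> linarith [hu.1, hu.2])
      (by linarith [abs_nonneg (η / 2)])
  · have := test_not_mem_tail (E := E) hδ hη h4 hd₀ hinj hmN hN0 (by omega) hu hc hS0.1 hS0.2 (μ := 0)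
      (by simpa using hstop0)
    exact this (by simpa using hzK)

/-! ### The inside path between inner test points -/

include hδ hη h4 hd₀ hball in
/-- **From the inner test point of `d_ν` to its lattice point**, off the first arc, the tails of `d₀, d_l`
and the outside set. [folklore] -/
theorem joinedIn_testIn_center' {l : ℕ} (hl : l < N) (ν n : ℕ)
    {S0 Sl : ℝ} (hS0 : η ≤ S0 ∧ S0 ≤ δ) (hSl : η ≤ Sl ∧ Sl ≤ δ)
    (hstop0 : d₀.1 + dir d₀.2 ∈ verts E → S0 ≤ δ - 2 * η)
    (hstopl : ((succ E)^[l] d₀).1 + dir ((succ E)^[l] d₀).2 ∈ verts E → Sl ≤ δ - 2 * η)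
    (hp0 : framePt δ d₀ S0 0 ∉ D.carrier) (hpl : framePt δ ((succ E)^[l] d₀) Sl 0 ∉ D.carrier)
    {RA : Set ℂ} (hRA : ∀ z ∈ RA, z ∉ closure D.carrier ∨ z = framePt δ ((succ E)^[l] d₀) Sl 0 ∨ z = framePt δ d₀ S0 0) :
    JoinedIn (range (arcPath E δ η d₀ n) ∪ (segment ℝ (framePt δ ((succ E)^[l] d₀) η 0) (framePt δ ((succ E)^[l] d₀) Sl 0) ∪
        RA ∪ segment ℝ (framePt δ d₀ η 0) (framePt δ d₀ S0 0)))ᶜ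
      (framePt δ ((succ E)^[ν] d₀) (η - η / 4) (η / 2)) (meshPoint δ ((succ E)^[ν] d₀).1) := by
  have hN0 : 0 < N := by omega
  rw [← framePt_origin ((succ E)^[ν] d₀).1 ((succ E)^[ν] d₀).2]
  refine JoinedIn.of_segment_subset fun z hz hzK => ?_
  obtain ⟨θ, hθ, rfl⟩ := exists_of_mem_segment_framePt hz
  have ha : |(1 - θ) * (η - η / 4) + θ * 0| < η := by
    rw [abs_lt]; constructor <;> nlinarith [hθ.1, hθ.2]
  have hb : |(1 - θ) * (η / 2) + θ * 0| < η := by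
    rw [abs_lt]; constructor <;> nlinarith [hθ.1, hθ.2]
  have hxν := (hd₀.iterate ν).1
  -- tails
  have htail : ∀ {μ : ℕ} {S : ℝ}, μ < N → η ≤ S ∧ S ≤ δ →
      (((succ E)^[μ] d₀).1 + dir ((succ E)^[μ] d₀).2 ∈ verts E → S ≤ δ - 2 * η) →
      framePt δ (((succ E)^[ν] d₀).1, ((succ E)^[ν] d₀).2) ((1 - θ) * (η - η / 4) + θ * 0) ((1 - θ) * (η / 2) + θ * 0) ∉
        segment ℝ (framePt δ ((succ E)^[μ] d₀) η 0) (framePt δ ((succ E)^[μ] d₀) S 0) := by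
    intro μ S hμ hS hstop hzT
    obtain ⟨s, hs, hzs⟩ := exists_of_mem_segment_fst hS.1 hzT
    exact inside_ne_tail hδ hη h4 hxν ha hb hs.1 (hs.2.trans hS.2) (fun h => by linarith [hstop h, hs.2]) hzs
  simp only [mem_union] at hzK
  rcases hzK with hzK | ((hzK | hzK) | hzK)
  · rcases side_or_conn_of_mem_range hη (by linarith) hd₀ n hzK with ⟨v, K, -, h⟩ | ⟨a, ha', t, ht, h⟩
    · exact inside_not_side hδ hη h4 ha hb h
    · exact inside_not_conn hδ hη h4 ha hb ha' ht h
  · exact htail hl hSl hstopl hzK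
  · refine not_mem_outside D hRA hpl hp0 (near_mem D hball hη hxν _ ?_ ?_) hzK
    · rw [abs_lt] at ha; rw [abs_le]; constructor <;> linarith [ha.1, ha.2]
    · rw [abs_lt] at hb; rw [abs_le]; constructor <;> linarith [hb.1, hb.2]
  · exact htail (μ := 0) hN0 hS0 (by simpa using hstop0) (by simpa using hzK)

include hδ hη h4 hd₀ in
/-- **An edge of `E` misses the first arc, the tails and the outside set.** [folklore] -/
theorem edge_subset_compl (hEcl : ∀ v w : Site 2, s(v, w) ∈ E → segment ℝ (meshPoint δ v) (meshPoint δ w) ⊆ closure D.carrier)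
    (hvertD : ∀ v ∈ verts E, meshPoint δ v ∈ D.carrier) {l : ℕ} (n : ℕ)
    {S0 Sl : ℝ} (hS0 : η ≤ S0 ∧ S0 ≤ δ) (hSl : η ≤ Sl ∧ Sl ≤ δ)
    (hp0 : framePt δ d₀ S0 0 ∉ D.carrier) (hpl : framePt δ ((succ E)^[l] d₀) Sl 0 ∉ D.carrier)
    {RA : Set ℂ} (hRA : ∀ z ∈ RA, z ∉ closure D.carrier ∨ z = framePt δ ((succ E)^[l] d₀) Sl 0 ∨ z = framePt δ d₀ S0 0)
    {b : Site 2} {K : Fin 4} (hbK : s(b, b + dir K) ∈ E) {z : ℂ}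
    (hz : z ∈ segment ℝ (meshPoint δ b) (meshPoint δ (b + dir K))) :
    z ∉ range (arcPath E δ η d₀ n) ∪ (segment ℝ (framePt δ ((succ E)^[l] d₀) η 0) (framePt δ ((succ E)^[l] d₀) Sl 0) ∪
        RA ∪ segment ℝ (framePt δ d₀ η 0) (framePt δ d₀ S0 0)) := by
  -- a tail point (parameter in `(0, S]`) of an external dart is on no edge of `E`
  have key : ∀ {μ : ℕ} {S s : ℝ}, 0 < S ∧ S ≤ δ → framePt δ ((succ E)^[μ] d₀) S 0 ∉ D.carrier → 0 < s → s ≤ S →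
      framePt δ ((succ E)^[μ] d₀) s 0 ∉ segment ℝ (meshPoint δ b) (meshPoint δ (b + dir K)) := by
    intro μ S s hS hp hs0 hsS hmem
    have hext := hd₀.iterate μ
    refine tail_not_mem_edge hδ (x := ((succ E)^[μ] d₀).1) (k := ((succ E)^[μ] d₀).2) hext.2 hs0 (hsS.trans hS.2)
      (fun hsδ hy => hp ?_) hbK (zdGraph_adj_add_dir b K) hmem
    have hSδ : S = δ := le_antisymm hS.2 (hsδ ▸ hsS)
    rw [show ((succ E)^[μ] d₀) = (((succ E)^[μ] d₀).1, ((succ E)^[μ] d₀).2) from rfl, hSδ, framePt_far]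
    exact hvertD _ hy
  simp only [mem_union, not_or]
  refine ⟨?_, ⟨?_, ?_⟩, ?_⟩
  · -- the polygon: split the edge at its midpoint
    intro hzΓ
    obtain ⟨t, ht, rfl⟩ := exists_of_mem_edge hδ hz
    rcases le_or_gt t (δ / 2) with htle | htgt
    · rcases side_or_conn_of_mem_range hη (by linarith) hd₀ n hzΓ with ⟨v, K', hext, h⟩ | ⟨a, ha', t', ht', h⟩
      · exact edgeLine_not_side hδ hη h4 hbK ⟨ht.1, htle⟩ hext h
      · exact edgeLine_not_conn hδ hη h4 ⟨ht.1, htle⟩ ha' ht' h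
    · have hrev : framePt δ (b, K) t 0 = framePt δ (b + dir K, K + 2) (δ - t) 0 := by
        rw [framePt_reverse b K t 0, neg_zero]
      have hbK' : aedge (b + dir K, K + 2) ∈ E := by rw [aedge_reverse]; exact hbK
      rw [hrev] at hzΓ
      rcases side_or_conn_of_mem_range hη (by linarith) hd₀ n hzΓ with ⟨v, K', hext, h⟩ | ⟨a, ha', t', ht', h⟩
      · exact edgeLine_not_side hδ hη h4 hbK' ⟨by linarith [ht.2], by linarith⟩ hext h
      · exact edgeLine_not_conn hδ hη h4 ⟨by linarith [ht.2], by linarith⟩ ha' ht' h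
  · intro hzT
    obtain ⟨s, hs, rfl⟩ := exists_of_mem_segment_fst hSl.1 hzT
    exact key ⟨by linarith [hSl.1], hSl.2⟩ hpl (by linarith [hs.1]) hs.2 hz
  · intro hzR
    rcases hRA z hzR with h | rfl | rfl
    · exact h (hEcl _ _ hbK hz)
    · exact key ⟨by linarith [hSl.1], hSl.2⟩ hpl (by linarith [hSl.1]) le_rfl hz
    · exact key (μ := 0) ⟨by linarith [hS0.1], hS0.2⟩ (by simpa using hp0) (by linarith [hS0.1]) le_rfl
        (by simpa using hz)
  · intro hzT
    obtain ⟨s, hs, rfl⟩ := exists_of_mem_segment_fst hS0.1 hzT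
    exact key (μ := 0) ⟨by linarith [hS0.1], hS0.2⟩ (by simpa using hp0) (by linarith [hs.1]) hs.2 (by simpa using hz)

include hδ hη h4 hd₀ hball in
/-- **The lattice point of a vertex is off the first arc, the tails and the outside set.** [folklore] -/
theorem center_not_mem {l : ℕ} (hl : l < N) (n : ℕ) {S0 Sl : ℝ} (hS0 : η ≤ S0 ∧ S0 ≤ δ) (hSl : η ≤ Sl ∧ Sl ≤ δ)
    (hstop0 : d₀.1 + dir d₀.2 ∈ verts E → S0 ≤ δ - 2 * η)
    (hstopl : ((succ E)^[l] d₀).1 + dir ((succ E)^[l] d₀).2 ∈ verts E → Sl ≤ δ - 2 * η)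
    (hp0 : framePt δ d₀ S0 0 ∉ D.carrier) (hpl : framePt δ ((succ E)^[l] d₀) Sl 0 ∉ D.carrier)
    {RA : Set ℂ} (hRA : ∀ z ∈ RA, z ∉ closure D.carrier ∨ z = framePt δ ((succ E)^[l] d₀) Sl 0 ∨ z = framePt δ d₀ S0 0)
    {x : Site 2} (hx : x ∈ verts E) :
    meshPoint δ x ∈ (range (arcPath E δ η d₀ n) ∪ (segment ℝ (framePt δ ((succ E)^[l] d₀) η 0)
      (framePt δ ((succ E)^[l] d₀) Sl 0) ∪ RA ∪ segment ℝ (framePt δ d₀ η 0) (framePt δ d₀ S0 0)))ᶜ := by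
  have h0 : |(0 : ℝ)| < η := by rw [abs_zero]; exact hη
  rw [← framePt_origin x 0]
  have htail : ∀ {μ : ℕ} {S : ℝ}, μ < N → η ≤ S ∧ S ≤ δ →
      (((succ E)^[μ] d₀).1 + dir ((succ E)^[μ] d₀).2 ∈ verts E → S ≤ δ - 2 * η) →
      framePt δ (x, 0) 0 0 ∉ segment ℝ (framePt δ ((succ E)^[μ] d₀) η 0) (framePt δ ((succ E)^[μ] d₀) S 0) := by
    intro μ S hμ hS hstop hzT
    obtain ⟨s, hs, hzs⟩ := exists_of_mem_segment_fst hS.1 hzT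
    exact inside_ne_tail hδ hη h4 hx h0 h0 hs.1 (hs.2.trans hS.2) (fun h => by linarith [hstop h, hs.2]) hzs
  simp only [mem_compl_iff, mem_union, not_or]
  refine ⟨?_, ⟨?_, ?_⟩, ?_⟩
  · intro hzK
    rcases side_or_conn_of_mem_range hη (by linarith) hd₀ n hzK with ⟨v, K, -, h⟩ | ⟨a, ha', t, ht, h⟩
    · exact inside_not_side hδ hη h4 h0 h0 h
    · exact inside_not_conn hδ hη h4 h0 h0 ha' ht h
  · exact htail hl hSl hstopl
  · exact not_mem_outside D hRA hpl hp0 (near_mem D hball hη hx _ (by rw [abs_zero]; positivity)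
      (by rw [abs_zero]; positivity))
  · exact htail (μ := 0) (by omega) hS0 (by simpa using hstop0)

include hδ hη h4 hd₀ hball in
/-- **Lattice points of connected vertices are joined off the first arc, the tails and the outside set.**
[folklore] -/
theorem joinedIn_centers (hE : ∀ e ∈ E, e ∈ (zdGraph 2).edgeSet)
    (hEcl : ∀ v w : Site 2, s(v, w) ∈ E → segment ℝ (meshPoint δ v) (meshPoint δ w) ⊆ closure D.carrier)
    (hvertD : ∀ v ∈ verts E, meshPoint δ v ∈ D.carrier) {l : ℕ} (hl : l < N) (n : ℕ)
    {S0 Sl : ℝ} (hS0 : η ≤ S0 ∧ S0 ≤ δ) (hSl : η ≤ Sl ∧ Sl ≤ δ)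
    (hstop0 : d₀.1 + dir d₀.2 ∈ verts E → S0 ≤ δ - 2 * η)
    (hstopl : ((succ E)^[l] d₀).1 + dir ((succ E)^[l] d₀).2 ∈ verts E → Sl ≤ δ - 2 * η)
    (hp0 : framePt δ d₀ S0 0 ∉ D.carrier) (hpl : framePt δ ((succ E)^[l] d₀) Sl 0 ∉ D.carrier)
    {RA : Set ℂ} (hRA : ∀ z ∈ RA, z ∉ closure D.carrier ∨ z = framePt δ ((succ E)^[l] d₀) Sl 0 ∨ z = framePt δ d₀ S0 0)
    {x y : Site 2} (hx : x ∈ verts E) (hxy : Relation.ReflTransGen (fun a b : Site 2 => s(a, b) ∈ E) x y) :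
    JoinedIn (range (arcPath E δ η d₀ n) ∪ (segment ℝ (framePt δ ((succ E)^[l] d₀) η 0) (framePt δ ((succ E)^[l] d₀) Sl 0) ∪
        RA ∪ segment ℝ (framePt δ d₀ η 0) (framePt δ d₀ S0 0)))ᶜ (meshPoint δ x) (meshPoint δ y) := by
  induction hxy with
  | refl => exact JoinedIn.refl (center_not_mem D hδ hη h4 hball hd₀ hl n hS0 hSl hstop0 hstopl hp0 hpl hRA hx)
  | @tail b c _ hbc ih =>
    obtain ⟨K, rfl⟩ := exists_eq_add_dir_of_adj (by
      have := hE _ hbc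
      rwa [SimpleGraph.mem_edgeSet] at this)
    exact ih.trans (JoinedIn.of_segment_subset fun z hz hzK =>
      edge_subset_compl D hδ hη h4 hd₀ hEcl hvertD n hS0 hSl hp0 hpl hRA hbc hz hzK)

end WindowRect

/-- **A frame point with both coordinates at most `5η/4` is within `2η` of its lattice point**, closed form
(registered sub-goal of stmt-CriticalPhenomena-10650). [folklore] -/
theorem windowRect_dist_framePt_lt_two : ∀ {δ η : ℝ}, 0 < η → ∀ (x : Site 2) (k : Fin 4) {a b : ℝ}, |a| ≤ 5 * η / 4 → |b| ≤ 5 * η / 4 → dist (WindowRect.framePt δ (x, k) a b) (meshPoint δ x) < 2 * η :=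
  fun hη x k _ _ ha hb => WindowRect.dist_framePt_lt_two hη x k ha hb

end Summit.CriticalPhenomena.SAWScalingLimit.Theorems.IsingBoundaryRatio

end
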